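import Summits.Ventures.CertifiedManyBodySolver.Rows.CorrWindowCertKernelChainQuotAdjFastN
import Mathlib.Data.Nat.Digits.Defs
import HarnessLib

/-!
# The chain step on LETTER CODES (part 2): the packed key is injective below the base; keyed collect = `collect`, encoded

Part 1 (`Rows/CorrWindowCertKernelChainQuotAdjFastN.lean`) is the code engine and its transport through a strictly monotone encoding `enc`.
Here: **`key_inj`** / `beq_key` — the packed sort key `Mono.key enc B` (CQC `Rows/CARNormalOrder.lean`) is INJECTIVE when every digit
`enc a + 1` is below the base `B` (read as a base-`B` numeral through `Nat.ofDigits`: annihilator digits, one `0` separator, creator digits;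
positive digits ⇒ unique), so the engine may compare monomials by their carried key alone; `sortByKeyB_eq` (the `Bool`-test bottom-up merge
sort IS `sortByKey`); `sortByKey_mapVal` (the key sort is parametric in the payload); `mergeAdjK_map`, **`collectK_map`**,
**`collectK_termsToPolyKN`** (the keyed raw normal form, collected, IS `normalizeS`, encoded). Parts 3–4: `…FastNStages.lean`, `…FastNBox.lean`.

HONEST FRAMING (xx1): Lean plumbing towards «tier P» — a PROOF-TERM-only speed-up of the kernel replay of chain steps; every
`step_s` STATEMENT, accumulator literal, census/EQUAL artefact, `ChainQAOK`/closer stays byte-identical. Nothing of record moves; no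
certificate is evaluated here; no claim node is discharged; CONTROL/CALIBRATION context; silent on the presence of superconductivity;
not a `T_c` or phase sentence; nothing about any material; no summit statement is proved by this file. Cell `hubbard-obs` ×
`hubbard-downfold` (D-0154 (1)(C) La214), seat hubbard-cov-la214-box-2 g6 (`prover-hubbard-cov-la214-box-2-g6-0`), zero compute.

References: C. Jansson, D. Chaykin, C. Keil, SIAM J. Numer. Anal. 46 (2008) 180 [JanssonChaykinKeil2008]; X. Han, arXiv:2006.06002 §3
[Han2020Bootstrap]; O. Bratteli, D. W. Robinson, *Operator Algebras and Quantum Statistical Mechanics 2* §5.2.2 [BratteliRobinsonII1997].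
-/

namespace Summit.Ventures.CertifiedManyBodySolver

namespace CARPolyWindow

open Summit.Ventures.CertifiedQuantumChemistry Summit.Ventures.CertifiedQuantumChemistry.CARPoly
open Literature.MathematicalPhysics.QuantumLattice Literature.MathematicalPhysics.QuantumLattice.HubbardWave0

section KeyInj

variable {α : Type*} [LinearOrder α] (enc : α → ℕ) (henc : ∀ x y : α, enc x < enc y ↔ x < y)
include henc

/-! ## §1 The packed key is injective below the base -/

omit [LinearOrder α] henc in
/-- The packing fold is a base-`B` numeral (little-endian digits = the reversed list). [folklore] -/
theorem foldl_pack_eq (B init : ℕ) : ∀ L : List ℕ,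
    L.foldl (fun acc v => acc * B + v) init = init * B ^ L.length + Nat.ofDigits B L.reverse
  | [] => by simp
  | v :: L => by
    rw [List.foldl_cons, foldl_pack_eq B (init * B + v) L, List.length_cons, List.reverse_cons, Nat.ofDigits_append,
      List.length_reverse, Nat.ofDigits_singleton, pow_succ]
    ring

omit [LinearOrder α] henc in
/-- The key as a numeral: annihilator digits (reversed), a `0` separator, creator digits (reversed); digits are `enc a + 1 ≥ 1`.
[folklore] -/
theorem key_eq_ofDigits (B : ℕ) (m : CARPoly.Mono α) :
    CARPoly.Mono.key enc B m =
      Nat.ofDigits B ((m.2.map fun a => enc a + 1).reverse ++ 0 :: (m.1.map fun a => enc a + 1).reverse) := by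
  unfold CARPoly.Mono.key
  rw [foldl_pack_eq, foldl_pack_eq, zero_mul, zero_add, Nat.ofDigits_append, Nat.ofDigits_cons]
  simp only [List.length_reverse, List.length_map]
  ring

omit [LinearOrder α] henc in
/-- Numerals with POSITIVE digits below the base are determined by their value. [folklore] -/
theorem ofDigits_inj_pos {B : ℕ} (hB : 1 < B) : ∀ (L1 L2 : List ℕ), (∀ d ∈ L1, 0 < d ∧ d < B) → (∀ d ∈ L2, 0 < d ∧ d < B) →
    Nat.ofDigits B L1 = Nat.ofDigits B L2 → L1 = L2
  | [], [], _, _, _ => rfl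
  | [], d :: L2, _, h2, h => by
    rw [Nat.ofDigits_nil, Nat.ofDigits_cons] at h
    have := (h2 d List.mem_cons_self).1; omega
  | d :: L1, [], h1, _, h => by
    rw [Nat.ofDigits_nil, Nat.ofDigits_cons] at h
    have := (h1 d List.mem_cons_self).1; omega
  | d :: L1, d' :: L2, h1, h2, h => by
    rw [Nat.ofDigits_cons, Nat.ofDigits_cons] at h
    have hd := (h1 d List.mem_cons_self).2; have hd' := (h2 d' List.mem_cons_self).2
    have e1 : d = d' := by
      have := congrArg (· % B) h; simp only [Nat.add_mul_mod_self_left, Nat.mod_eq_of_lt hd, Nat.mod_eq_of_lt hd'] at this; exact this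
    subst e1
    have e2 : Nat.ofDigits B L1 = Nat.ofDigits B L2 := by
      have hB0 : 0 < B := by omega
      have := congrArg (· / B) h
      simp only [Nat.add_mul_div_left _ _ hB0, Nat.div_eq_of_lt hd, zero_add] at this; exact this
    rw [ofDigits_inj_pos hB L1 L2 (fun x hx => h1 x (List.mem_cons_of_mem _ hx)) (fun x hx => h2 x (List.mem_cons_of_mem _ hx)) e2]

omit [LinearOrder α] henc in
/-- Numerals «positive digits, one `0`, positive digits» are determined by their value. [folklore] -/
theorem ofDigits_inj_sep {B : ℕ} (hB : 1 < B) : ∀ (X1 X2 Y1 Y2 : List ℕ), (∀ d ∈ X1, 0 < d ∧ d < B) → (∀ d ∈ X2, 0 < d ∧ d < B) →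
    (∀ d ∈ Y1, 0 < d ∧ d < B) → (∀ d ∈ Y2, 0 < d ∧ d < B) →
    Nat.ofDigits B (X1 ++ 0 :: Y1) = Nat.ofDigits B (X2 ++ 0 :: Y2) → X1 = X2 ∧ Y1 = Y2
  | [], [], Y1, Y2, _, _, hY1, hY2, h => by
    rw [List.nil_append, List.nil_append, Nat.ofDigits_cons, Nat.ofDigits_cons, zero_add, zero_add] at h
    exact ⟨rfl, ofDigits_inj_pos hB Y1 Y2 hY1 hY2 (Nat.eq_of_mul_eq_mul_left (by omega) h)⟩
  | [], d :: X2, Y1, Y2, _, hX2, _, _, h => by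
    rw [List.nil_append, List.cons_append, Nat.ofDigits_cons, Nat.ofDigits_cons, zero_add] at h
    have hd := hX2 d List.mem_cons_self
    have := congrArg (· % B) h; simp only [Nat.mul_mod_right, Nat.add_mul_mod_self_left, Nat.mod_eq_of_lt hd.2] at this; omega
  | d :: X1, [], Y1, Y2, hX1, _, _, _, h => by
    rw [List.nil_append, List.cons_append, Nat.ofDigits_cons, Nat.ofDigits_cons, zero_add] at h
    have hd := hX1 d List.mem_cons_self
    have := congrArg (· % B) h; simp only [Nat.mul_mod_right, Nat.add_mul_mod_self_left, Nat.mod_eq_of_lt hd.2] at this; omega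
  | d :: X1, d' :: X2, Y1, Y2, hX1, hX2, hY1, hY2, h => by
    rw [List.cons_append, List.cons_append, Nat.ofDigits_cons, Nat.ofDigits_cons] at h
    have hd := (hX1 d List.mem_cons_self).2; have hd' := (hX2 d' List.mem_cons_self).2
    have e1 : d = d' := by
      have := congrArg (· % B) h; simp only [Nat.add_mul_mod_self_left, Nat.mod_eq_of_lt hd, Nat.mod_eq_of_lt hd'] at this; exact this
    subst e1
    have e2 : Nat.ofDigits B (X1 ++ 0 :: Y1) = Nat.ofDigits B (X2 ++ 0 :: Y2) := by
      have hB0 : 0 < B := by omega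
      have := congrArg (· / B) h
      simp only [Nat.add_mul_div_left _ _ hB0, Nat.div_eq_of_lt hd, zero_add] at this; exact this
    obtain ⟨hx, hy⟩ := ofDigits_inj_sep hB X1 X2 Y1 Y2 (fun x hx => hX1 x (List.mem_cons_of_mem _ hx))
      (fun x hx => hX2 x (List.mem_cons_of_mem _ hx)) hY1 hY2 e2
    exact ⟨by rw [hx], hy⟩

/-- **The packed key is injective** when every digit `enc a + 1` is below the base. [folklore] -/
theorem key_inj {B : ℕ} (hbd : ∀ a : α, enc a + 1 < B) (hB : 1 < B) {m n : CARPoly.Mono α}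
    (h : CARPoly.Mono.key enc B m = CARPoly.Mono.key enc B n) : m = n := by
  rw [key_eq_ofDigits, key_eq_ofDigits] at h
  have hdig : ∀ (L : List α), ∀ d ∈ (L.map fun a => enc a + 1).reverse, 0 < d ∧ d < B := by
    intro L d hd
    rw [List.mem_reverse, List.mem_map] at hd
    obtain ⟨a, _, rfl⟩ := hd
    exact ⟨Nat.succ_pos _, hbd a⟩
  obtain ⟨h2, h1⟩ := ofDigits_inj_sep hB _ _ _ _ (hdig m.2) (hdig n.2) (hdig m.1) (hdig n.1) h
  have hinj : Function.Injective (fun a : α => enc a + 1) := fun a b hab =>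
    enc_inj_of_strict enc henc (by simpa using hab)
  have e1 := List.map_injective_iff.2 hinj (List.reverse_injective h1)
  have e2 := List.map_injective_iff.2 hinj (List.reverse_injective h2)
  exact Prod.ext e1 e2

/-- The key test decides monomial equality below the base. [folklore] -/
theorem beq_key {B : ℕ} (hbd : ∀ a : α, enc a + 1 < B) (hB : 1 < B) (m n : CARPoly.Mono α) :
    Nat.beq (CARPoly.Mono.key enc B m) (CARPoly.Mono.key enc B n) = decide (m = n) := by
  rw [Bool.eq_iff_iff, Nat.beq_eq, decide_eq_true_iff]
  exact ⟨key_inj enc henc hbd hB, fun h => h ▸ rfl⟩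

end KeyInj

/-! ## §2 Keyed collect = collect, encoded -/

section CollectTransport

variable {β γ : Type*}

/-- The `Bool` merge step IS `mergeStep`. [folklore] -/
theorem mergeStepB_eq (x : ℕ × β) (kont : List (ℕ × β) → List (ℕ × β)) : ∀ ys, mergeStepB x kont ys = CARPoly.mergeStep x kont ys
  | [] => rfl
  | y :: ys => by
    rw [mergeStepB, CARPoly.mergeStep, mergeStepB_eq x kont ys]
    have e : Nat.ble x.1 y.1 = decide (x.1 ≤ y.1) := by rw [Bool.eq_iff_iff, Nat.ble_eq, decide_eq_true_iff]
    rw [e]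
    by_cases h : x.1 ≤ y.1
    · rw [decide_eq_true h, cond_true, if_pos h]
    · rw [decide_eq_false h, cond_false, if_neg h]

/-- The `Bool` key merge IS `mergeByKey`. [folklore] -/
theorem mergeByKeyB_eq : ∀ xs ys : List (ℕ × β), mergeByKeyB xs ys = CARPoly.mergeByKey xs ys
  | [], ys => rfl
  | x :: xs, ys => by
    rw [mergeByKeyB, CARPoly.mergeByKey]
    have hk : mergeByKeyB xs = CARPoly.mergeByKey xs := funext (mergeByKeyB_eq xs)
    rw [hk, mergeStepB_eq]

/-- The `Bool` pass IS `mergePairs`. [folklore] -/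
theorem mergePairsB_eq : ∀ L : List (List (ℕ × β)), mergePairsB L = CARPoly.mergePairs L
  | [] => rfl
  | [a] => rfl
  | a :: b :: rest => by rw [mergePairsB, CARPoly.mergePairs, mergeByKeyB_eq, mergePairsB_eq rest]

/-- The `Bool` bottom-up sort IS `mergeAll`. [folklore] -/
theorem mergeAllB_eq : ∀ (f : ℕ) (L : List (List (ℕ × β))), mergeAllB f L = CARPoly.mergeAll f L
  | 0, L => rfl
  | _ + 1, [] => rfl
  | _ + 1, [l] => rfl
  | f + 1, a :: b :: rest => by rw [mergeAllB, CARPoly.mergeAll, mergePairsB_eq, mergeAllB_eq f]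

/-- **`sortByKeyB` IS `sortByKey`.** [folklore] -/
theorem sortByKeyB_eq (L : List (ℕ × β)) : sortByKeyB L = CARPoly.sortByKey L := by
  rw [sortByKeyB, CARPoly.sortByKey, mergeAllB_eq]

/-- `mergeStep` is parametric in the payload. [folklore] -/
theorem mergeStep_mapVal (g : β → γ) (x : ℕ × β) (kont : List (ℕ × β) → List (ℕ × β)) (kont' : List (ℕ × γ) → List (ℕ × γ))
    (hk : ∀ zs, kont' (zs.map fun p => (p.1, g p.2)) = (kont zs).map fun p => (p.1, g p.2)) :
    ∀ ys : List (ℕ × β), CARPoly.mergeStep (x.1, g x.2) kont' (ys.map fun p => (p.1, g p.2)) =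
      (CARPoly.mergeStep x kont ys).map fun p => (p.1, g p.2)
  | [] => by rw [List.map_nil, CARPoly.mergeStep, CARPoly.mergeStep, List.map_cons, ← hk [], List.map_nil]
  | y :: ys => by
    rw [List.map_cons, CARPoly.mergeStep, CARPoly.mergeStep]
    dsimp only
    split_ifs with h
    · rw [List.map_cons, ← hk (y :: ys), List.map_cons]
    · rw [List.map_cons, mergeStep_mapVal g x kont kont' hk ys]

/-- `mergeByKey` is parametric in the payload. [folklore] -/
theorem mergeByKey_mapVal (g : β → γ) : ∀ xs ys : List (ℕ × β),
    CARPoly.mergeByKey (xs.map fun p => (p.1, g p.2)) (ys.map fun p => (p.1, g p.2)) =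
      (CARPoly.mergeByKey xs ys).map fun p => (p.1, g p.2)
  | [], ys => by simp [CARPoly.mergeByKey]
  | x :: xs, ys => by
    rw [List.map_cons, CARPoly.mergeByKey, CARPoly.mergeByKey]
    exact mergeStep_mapVal g x _ _ (fun zs => mergeByKey_mapVal g xs zs) ys

/-- `mergePairs` is parametric in the payload. [folklore] -/
theorem mergePairs_mapVal (g : β → γ) : ∀ L : List (List (ℕ × β)),
    CARPoly.mergePairs (L.map fun l => l.map fun p => (p.1, g p.2)) =
      (CARPoly.mergePairs L).map fun l => l.map fun p => (p.1, g p.2)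
  | [] => rfl
  | [a] => rfl
  | a :: b :: rest => by
    rw [List.map_cons, List.map_cons, CARPoly.mergePairs, CARPoly.mergePairs, List.map_cons, mergeByKey_mapVal,
      mergePairs_mapVal g rest]

/-- `mergeAll` is parametric in the payload. [folklore] -/
theorem mergeAll_mapVal (g : β → γ) : ∀ (f : ℕ) (L : List (List (ℕ × β))),
    CARPoly.mergeAll f (L.map fun l => l.map fun p => (p.1, g p.2)) =
      (CARPoly.mergeAll f L).map fun p => (p.1, g p.2)
  | 0, L => by simp [CARPoly.mergeAll, List.map_flatten]
  | _ + 1, [] => rfl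
  | _ + 1, [l] => rfl
  | f + 1, a :: b :: rest => by
    rw [List.map_cons, List.map_cons, CARPoly.mergeAll, CARPoly.mergeAll, ← mergeAll_mapVal g f, ← List.map_cons, ← List.map_cons,
      mergePairs_mapVal]

/-- **`sortByKey` is parametric in the payload.** [folklore] -/
theorem sortByKey_mapVal (g : β → γ) (L : List (ℕ × β)) :
    CARPoly.sortByKey (L.map fun p => (p.1, g p.2)) = (CARPoly.sortByKey L).map fun p => (p.1, g p.2) := by
  rw [CARPoly.sortByKey, CARPoly.sortByKey, ← mergeAll_mapVal, List.map_map, List.map_map]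
  rfl

variable {α : Type*} [LinearOrder α] (enc : α → ℕ) (henc : ∀ x y : α, enc x < enc y ↔ x < y)
include henc

omit [LinearOrder α] henc in
/-- `emitK` on an encoded term is `emit`, encoded. [folklore] -/
theorem emitK_map (B : ℕ) (m : CARPoly.Mono α) (q : ℚ) (rest : CARPoly.Poly α) :
    emitK (encKT enc B (m, q)) (rest.map (encKT enc B)) = (CARPoly.emit m q rest).map (encKT enc B) := by
  unfold emitK CARPoly.emit
  dsimp only [encKT]
  split_ifs <;> rfl

/-- `mergeAdjK` on encoded terms is `mergeAdj`, encoded (below the base). [folklore] -/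
theorem mergeAdjK_map {B : ℕ} (hbd : ∀ a : α, enc a + 1 < B) (hB : 1 < B) : ∀ (m : CARPoly.Mono α) (q : ℚ) (rest : CARPoly.Poly α),
    mergeAdjK (encKT enc B (m, q)) (rest.map (encKT enc B)) = (CARPoly.mergeAdj m q rest).map (encKT enc B)
  | m, q, [] => by
    rw [List.map_nil, mergeAdjK, CARPoly.mergeAdj, ← List.map_nil (f := encKT enc B), emitK_map enc]
  | m, q, mq :: rest => by
    rw [List.map_cons, mergeAdjK, CARPoly.mergeAdj]
    have hk : Nat.beq (encKT enc B (m, q)).1 (encKT enc B mq).1 = decide (m = mq.1) := beq_key enc henc hbd hB m mq.1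
    rw [hk]
    by_cases h : m = mq.1
    · rw [decide_eq_true h, cond_true, if_pos h, ← mergeAdjK_map hbd hB m (CARPoly.qforce (q + mq.2)) rest]
      rfl
    · rw [decide_eq_false h, cond_false, if_neg h, mergeAdjK_map hbd hB mq.1 mq.2 rest, emitK_map enc]

/-- **Keyed collect of encoded terms IS `collect`, encoded.** [folklore] -/
theorem collectK_map {B : ℕ} (hbd : ∀ a : α, enc a + 1 < B) (hB : 1 < B) (P : CARPoly.Poly α) :
    collectK (P.map (encKT enc B)) = (CARPoly.collect enc B P).map (encKT enc B) := by
  have e : P.map (encKT enc B) = (P.map fun mq => (CARPoly.Mono.key enc B mq.1, mq)).map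
      (fun p => (p.1, (fun mq : CARPoly.Mono α × ℚ => (encM enc mq.1, mq.2)) p.2)) := by
    rw [List.map_map]; rfl
  -- every tagged key IS the key of its monomial (sortByKey permutes the tagged list)
  have hmem : ∀ p ∈ CARPoly.sortByKey (P.map fun mq => (CARPoly.Mono.key enc B mq.1, mq)), p.1 = CARPoly.Mono.key enc B p.2.1 := by
    intro p hp
    have hp' := (CARPoly.sortByKey_perm _).subset hp
    rw [List.mem_map] at hp'
    obtain ⟨mq, _, rfl⟩ := hp'
    rfl
  rw [collectK, sortByKeyB_eq, CARPoly.collect, e, sortByKey_mapVal (fun mq : CARPoly.Mono α × ℚ => (encM enc mq.1, mq.2))]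
  generalize hS : CARPoly.sortByKey (P.map fun mq => (CARPoly.Mono.key enc B mq.1, mq)) = L at hmem ⊢
  rcases L with _ | ⟨⟨k, ⟨m, q⟩⟩, rest⟩
  · rfl
  · simp only [List.map_cons]
    have hk : k = CARPoly.Mono.key enc B m := hmem _ List.mem_cons_self
    have hrest : rest.map (fun p => (p.1, (fun mq : CARPoly.Mono α × ℚ => (encM enc mq.1, mq.2)) p.2)) =
        (rest.map Prod.snd).map (encKT enc B) := by
      rw [List.map_map]
      apply List.map_congr_left
      intro p hp
      have := hmem p (List.mem_cons_of_mem _ hp)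
      simp only [Function.comp, encKT, this]
    have hhead : ((k, (fun mq : CARPoly.Mono α × ℚ => (encM enc mq.1, mq.2)) (m, q)) : KTerm) = encKT enc B (m, q) := by
      rw [hk]; rfl
    rw [hrest, hhead]
    exact mergeAdjK_map enc henc hbd hB m q (rest.map Prod.snd)

/-- **The keyed raw normal form, collected, IS `normalizeS`, encoded.** [folklore] -/
theorem collectK_termsToPolyKN {B : ℕ} (hbd : ∀ a : α, enc a + 1 < B) (hB : 1 < B) (T : List (List (α × Bool) × ℚ)) :
    collectK (termsToPolyKN enc B T) = (normalizeS enc B T).map (encKT enc B) := by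
  rw [termsToPolyKN_eq enc henc, collectK_map enc henc hbd hB, normalizeS]

end CollectTransport

end CARPolyWindow

end Summit.Ventures.CertifiedManyBodySolver
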